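import Summits.CriticalPhenomena.PercolationContinuityZ3.Theorems.Transplant.BoxProdZ2ConcParams
import HarnessLib

/-!
# (S) UNPACKING `AtQ` at the concrete choices `Conc.choiceAt` / `concChoice₀` (design (D), `X □ ℤ²`): the hypotheses of the three raw
# residue theorems ((R) `rootOblA_concG` / (F) `faceOblC_concGB` / (C) `reachOblR_concGB` ∘ `hkits_reachTCD`) BY NAME — inputs at the running
# parameter at every accuracy `a ≥ δmin`, the counts, the excess radius, the schedule facts and the level / planar constants
# (the shared side conditions (S) of the owner split 15:02:43Z)

builds on p205010 (kernel theorem, internal audit signed; external expert review pending) — nothing in this file uses p205010.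
Status sentence (coordinator 2026-08-20T04:30Z): "θ(p_c) = 0 on ℤ^d, all d ≥ 2 — kernel-verified (Lean 4/Mathlib, standard axioms); internal adversarial
audit SIGNED 2026-08-20 04:29Z; external expert review pending."
Lane `prim-bschramm-*`, seat `prim-bschramm-stmt` (gen 6); helper file (`--supports stmt-CriticalPhenomena-4575`).

For `hat : (Conc.choiceAt κ X hqt w p hT hδA).AtQ msel M q` (kit scale `M := M₀`): `hmsel_at`, `half_le_at`, `le_at`, `tube_at`, `inputs_at`;
**`hstd_at` / `hlink_at` / `hlink_at₁`** (accuracy `a²`, any `a ≥ δmin κ 44 δA`); **`hk_at` / `hcount_at` / `hcount_Icc_at` / `hN_at`**;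
**`hR₁_at`** ((F)'s `hR₁`, `R₁ ρ := Rexc q (ρ+1)`), **`hRex_at`** ((C)/(R), every `R₀'`), **`hRexV_at`** (over the representatives: inner routes);
schedule `hgap_face` / `hgapL` / `hsch` / `hRt`; radii `hL_face` / `hL_reach` / `L'_le_Erad` / `ψ_le_E₀` / `ψ_top_le_E₀` / `ψ_le_Erad` /
`inner_rim_le`; planar `hr` / `hR100` / `hRl` / `hℓ₀` / `hRlev` / `hRlev'` / `hK₀`.
[cite: KozmaNitzan2024, §4 Theorem 6 (pp. 25–31); Lemma 10 (pp. 17–21); Lemma 12 (p. 24)]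
-/

noncomputable section

open MeasureTheory
open scoped Classical

namespace Summit.CriticalPhenomena.PercolationContinuityZ3.Theorems

namespace Transplant

namespace BoxProdZ2

open Literature.Probability.Percolation Literature.Probability.LatticeModels SimpleGraph KNCells KNLevels
open Literature.Probability.Percolation.GM (HOct piece)
open Literature.Barriers.CriticalPhenomena (IsQuasiTransitive IsGraphAmenable)

/-! ## Unpacking `AtQ` at the concrete choices -/

namespace Conc

/-! ### The planar / level constants (no law involved) -/

section Consts

variable {κ : ConcConsts} {W : Type} [Countable W] {X : SimpleGraph W} [X.LocallyFinite] {hqt : IsQuasiTransitive X}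
  {p : unitInterval} {hT : TubeSubcritical X p} {δA : ℝ} {M : ℕ}

/-- The kit scale lies in the scale set. [folklore] -/
theorem mem_Sc : M ∈ Sc κ X hqt p hT δA M := Finset.mem_Icc.2 ⟨le_rfl, (lt_six_mul_tOf κ.K₀ M _).le⟩

/-- The route scales `[M+1, 6t]` lie in the scale set. [folklore] -/
theorem Icc_subset_Sc : Finset.Icc (M + 1) (6 * tc κ X hqt p hT δA M) ⊆ Sc κ X hqt p hT δA M :=
  Finset.Icc_subset_Icc_left (Nat.le_succ M)

/-- `ψ M ≤ ψ (6 t)` (the kit scale is below the top route scale). [folklore] -/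
theorem ψ_le_ψ_top : ψ X hqt p hT M ≤ ψ X hqt p hT (6 * tc κ X hqt p hT δA M) :=
  ufatRadius_mono X hT _ (lt_six_mul_tOf κ.K₀ M _).le

/-- `r = 4 t`. [folklore] -/
theorem hr : (Cc κ X hqt p hT δA M).r = 4 * tc κ X hqt p hT δA M := cellsOf_r _ _

/-- `100 R' ≤ t`. [folklore] -/
theorem hR100 : 100 * R'c κ X hqt p hT δA M ≤ tc κ X hqt p hT δA M := hundred_mul_le_tOf _ _

/-- `Rlev + 1 ≤ R'` for `Rlev := M + L` (with equality). [folklore] -/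
theorem hRl : M + Lc κ X hqt p hT δA M + 1 ≤ R'c κ X hqt p hT δA M := le_rfl

/-- `R' + (M + 1) ≤ t` (the route scales `ℓ₀ := M + 1` fit in one advance: (C)'s `hℓ`). [folklore] -/
theorem hℓ₀ : R'c κ X hqt p hT δA M + (M + 1) ≤ tc κ X hqt p hT δA M := by
  have h := hundred_mul_succ_le_tOf κ.K₀ (R'c κ X hqt p hT δA M)
  unfold tc; unfold R'c at h ⊢; omega

/-- `Rlev + 3 ≤ 10 s` for `Rlev := M + L` ((F)'s `hRlev`). [folklore] -/
theorem hRlev : M + Lc κ X hqt p hT δA M + 3 ≤ 10 * (Cc κ X hqt p hT δA M).s := levels_le_ten_mul_s _ _ _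

/-- `Rlev + 1 ≤ 3 r` ((F)'s `hRlev'`). [folklore] -/
theorem hRlev' : M + Lc κ X hqt p hT δA M + 1 ≤ 3 * (Cc κ X hqt p hT δA M).r := levels_le_three_mul_r _ _ _

/-- `L + 2 M + 2 ≤ 10 s` (the `hwide` arithmetic). [folklore] -/
theorem hwide : Lc κ X hqt p hT δA M + 2 * M + 2 ≤ 10 * (Cc κ X hqt p hT δA M).s := wide_le_ten_mul_s _ _ _

/-- `K₀ ≤ K`. [folklore] -/
theorem hK₀ : κ.K₀ ≤ (Cc κ X hqt p hT δA M).K := K₀_le_cellsOf_K _ _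

/-- `K = max 20 K₀`. [folklore] -/
theorem Cc_K : (Cc κ X hqt p hT δA M).K = Kof κ.K₀ := rfl

/-- `s = 400 (R' + 1)`. [folklore] -/
theorem Cc_s : (Cc κ X hqt p hT δA M).s = 400 * (R'c κ X hqt p hT δA M + 1) := rfl

/-- **`hN`**: `k · B ≤ N` (needs `0 < δA`, `0 < p < 1`). [folklore] -/
theorem hN_at (h0 : 0 < δA) (hp0 : 0 < (p : ℝ)) (hp1 : (p : ℝ) < 1) :
    kc κ X hqt p hT δA M * kitB κ.Δ M (ψ X hqt p hT M) ≤ Nc κ X hqt p hT δA M :=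
  kitK_mul_le_kitN _ _ _ (δmin_pos κ nR h0) p hp0 hp1

/-- `0 < L`. [folklore] -/
theorem Lc_pos (h0 : 0 < δA) (hp0 : 0 < (p : ℝ)) (hp1 : (p : ℝ) < 1) : 0 < Lc κ X hqt p hT δA M :=
  kitL_pos _ _ _ (δmin_pos κ nR h0) p hp0 hp1

end Consts

/-! ### The scheme, the inputs at the running parameter, the counts and the excess radius -/

section AtQ

variable {κ : ConcConsts} {W : Type} [DecidableEq W] [Countable W] {X : SimpleGraph W} [X.LocallyFinite] {hqt : IsQuasiTransitive X}
  {w : W} {p : unitInterval} {hT : TubeSubcritical X p} {δA : ℝ} {hδA : 0 < δA} {msel : W → ℕ} {M : ℕ} {q : unitInterval}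

/-- The scheme of the concrete choices is `concSchemeG X C w Λ q κ.δ` with the concrete `C`, `Λ` (by `rfl`). [folklore] -/
theorem scheme_eq (hδA : 0 < δA) (msel : W → ℕ) (M : ℕ) (q : unitInterval) :
    (choiceAt κ X hqt w p hT hδA).scheme msel M q =
      concSchemeG X (Cc κ X hqt p hT δA M) w (concRadiiGB (Cc κ X hqt p hT δA M) (gapc κ X hqt w p hT δA M q) (fun _ => 0)
        (E₀c κ X hqt w p hT δA M q) (L'c κ X hqt w p hT δA M q)) q κ.δ := rfl

/-- The face data of the concrete choices (by `rfl`). [folklore] -/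
theorem faces_eq (hδA : 0 < δA) (msel : W → ℕ) (M : ℕ) (q : unitInterval) :
    (choiceAt κ X hqt w p hT hδA).faces msel M q =
      faceDataCG X (Cc κ X hqt p hT δA M) w (concRadiiGB (Cc κ X hqt p hT δA M) (gapc κ X hqt w p hT δA M q) (fun _ => 0)
        (E₀c κ X hqt w p hT δA M q) (L'c κ X hqt w p hT δA M q)) := rfl

variable (hat : (choiceAt κ X hqt w p hT hδA).AtQ msel M q)
include hat

/-- `msel τ ≤ M` on the representatives. [folklore] -/
theorem hmsel_at : ∀ τ ∈ reps X hqt, msel τ ≤ M := fun τ hτ => (hat.1 τ hτ).2.le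

/-- `msel τ < M` on the representatives. [folklore] -/
theorem hmsel_lt_at : ∀ τ ∈ reps X hqt, msel τ < M := fun τ hτ => (hat.1 τ hτ).2

/-- `p / 2 ≤ q`. [folklore] -/
theorem half_le_at : (p : ℝ) / 2 ≤ q := hat.2.1

/-- `q ≤ p`. [folklore] -/
theorem le_at : (q : ℝ) ≤ p := hat.2.2.1

/-- `TubeSubcritical X q`. [folklore] -/
theorem tube_at : TubeSubcritical X q := hat.2.2.2.2

/-- The inputs at `q` over `reps × Icc M (6 t)` at accuracy `δmin²`. [folklore] -/
theorem inputs_at : ∀ i ∈ inputIndex (reps X hqt) (Sc κ X hqt p hT δA M),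
    1 - δmin κ nR δA ^ 2 < (bondPercolation (X □ zdGraph 2) q).real (inputEvent X hT (reps X hqt) msel i) := hat.2.2.2.1

/-- **`hstd` at the kit scale `M`** at any accuracy `a ≥ δmin` (so `a := δ`, `δ₂`, `δr 44`, `δA`, `δUP n (δ₂²)`). [folklore] -/
theorem hstd_at {a : ℝ} (ha : δmin κ nR δA ≤ a) : ∀ τ ∈ reps X hqt,
    1 - a ^ 2 < (bondPercolation (X □ zdGraph 2) q).real (UniqZone.zone (X □ zdGraph 2) (ufatSeq X hT (reps X hqt) τ) (msel τ) M) ∧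
      ∀ g : HOct 2, 1 - a ^ 2 < (bondPercolation (X □ zdGraph 2) q).real (linkIn (↑(ufatSeq X hT (reps X hqt) τ M))
        (ufatSeq X hT (reps X hqt) τ (msel τ)) (ballFin X τ (ufatRadius X hT (reps X hqt) M) ×ˢ piece g M)) :=
  hstd_of_inputs_le X hT (reps X hqt) msel (δmin_sq_le hδA ha) (inputs_at hat) mem_Sc

/-- **`hlink` at the route scales `ℓ ∈ [M+1, 6t]`** at any accuracy `a ≥ δmin`. [folklore] -/
theorem hlink_at {a : ℝ} (ha : δmin κ nR δA ≤ a) : ∀ ℓ, M + 1 ≤ ℓ → ℓ ≤ 6 * tc κ X hqt p hT δA M → ∀ τ ∈ reps X hqt, ∀ g : HOct 2,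
    1 - a ^ 2 < (bondPercolation (X □ zdGraph 2) q).real (linkIn (↑(ufatSeq X hT (reps X hqt) τ ℓ))
      (ufatSeq X hT (reps X hqt) τ (msel τ)) (ballFin X τ (ufatRadius X hT (reps X hqt) ℓ) ×ˢ piece g ℓ)) :=
  hlink_of_inputs_le X hT (reps X hqt) msel (δmin_sq_le hδA ha) (inputs_at hat) Icc_subset_Sc

/-- **`hlink` at ONE scale `ℓ ∈ [M, 6t]`** at any accuracy `a ≥ δmin` (the root's first hop at `ℓ = 6t`). [folklore] -/
theorem hlink_at₁ {a : ℝ} (ha : δmin κ nR δA ≤ a) {ℓ : ℕ} (h₁ : M ≤ ℓ) (h₂ : ℓ ≤ 6 * tc κ X hqt p hT δA M) : ∀ τ ∈ reps X hqt,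
    ∀ g : HOct 2, 1 - a ^ 2 < (bondPercolation (X □ zdGraph 2) q).real (linkIn (↑(ufatSeq X hT (reps X hqt) τ ℓ))
      (ufatSeq X hT (reps X hqt) τ (msel τ)) (ballFin X τ (ufatRadius X hT (reps X hqt) ℓ) ×ˢ piece g ℓ)) :=
  fun τ hτ g => ((hstd_of_inputs_le X hT (reps X hqt) msel (δmin_sq_le hδA ha) (inputs_at hat) (M := ℓ)
    (Finset.mem_Icc.2 ⟨h₁, h₂⟩)) τ hτ).2 g

/-- **`hk`** at any accuracy `a ≥ δmin`: `(1 - q^{s_B})^k ≤ a`. [folklore] -/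
theorem hk_at (hp0 : 0 < (p : ℝ)) (hp1 : (p : ℝ) < 1) {a : ℝ} (ha : δmin κ nR δA ≤ a) :
    (1 - (q : ℝ) ^ kitSB κ.Δ M (ψ X hqt p hT M)) ^ kc κ X hqt p hT δA M ≤ a :=
  (kit_counts_at_le _ _ _ (δmin_pos κ nR hδA) ha p hp0 hp1 (half_le_at hat) (le_at hat)).1

/-- **`hcount`** at any accuracy `a ≥ δmin` and any level count `L' ≥ L`: `1/(1-q)^{(Δ+4) N} ≤ a · L'`. [folklore] -/
theorem hcount_at (hp0 : 0 < (p : ℝ)) (hp1 : (p : ℝ) < 1) {a : ℝ} (ha : δmin κ nR δA ≤ a) {L' : ℕ}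
    (hL' : Lc κ X hqt p hT δA M ≤ L') : 1 / (1 - (q : ℝ)) ^ ((κ.Δ + 4) * Nc κ X hqt p hT δA M) ≤ a * (L' : ℝ) :=
  (kit_counts_at_le _ _ _ (δmin_pos κ nR hδA) ha p hp0 hp1 (half_le_at hat) (le_at hat)).2 L' hL'

/-- **`hcount`** for the window `Icc (M+1) (M+L)` (card `L`). [folklore] -/
theorem hcount_Icc_at (hp0 : 0 < (p : ℝ)) (hp1 : (p : ℝ) < 1) {a : ℝ} (ha : δmin κ nR δA ≤ a) :
    1 / (1 - (q : ℝ)) ^ ((κ.Δ + 4) * Nc κ X hqt p hT δA M) ≤ a * ((Finset.Icc (M + 1) (M + Lc κ X hqt p hT δA M)).card : ℝ) := by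
  rw [card_Icc_levels]; exact hcount_at hat hp0 hp1 ha le_rfl

/-- **The excess radius at `q`, `τ ∈ {w}` form with entrance radius `ρ + 1`** ((F)'s `hR₁` with `R₁ ρ := Rex q (ρ+1)`), any `η ≥ δmin/2`. [folklore] -/
theorem hR₁_at {η : ℝ} (hη : ηc κ δA ≤ η) : ∀ ρ R', Rexc κ X hqt w p hT δA M q (ρ + 1) ≤ R' → ∀ τ ∈ ({w} : Finset W),
    ∀ (Rw : ℕ) (D A : Finset (W × Site 2)), D ⊆ ballFin X τ Rw ×ˢ box 2 (25 * (Cc κ X hqt p hT δA M).r) → A ⊆ D →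
      (∀ a ∈ A, a.1 ∈ ballFin X τ (ρ + 1)) → (bondPercolation (X □ zdGraph 2) q).real (excess X τ R' D A) ≤ η :=
  fun ρ R' hR' τ hτ Rw D A hD hA hnear => (excessRadiusAt_spec_singleton X (Finset.mem_insert_self w _) _
    (half_pos (δmin_pos κ nR hδA)) (tube_at hat) ρ R' hR' τ hτ Rw D A hD hA hnear).trans hη

/-- **The excess radius at `q`, `τ ∈ {w}` form at every entrance radius** ((C)'s `hRex`, (R)'s `hexc` input), any `η ≥ δmin/2`. [folklore] -/
theorem hRex_at {η : ℝ} (hη : ηc κ δA ≤ η) : ∀ R₀' R', Rexc κ X hqt w p hT δA M q R₀' ≤ R' → ∀ τ ∈ ({w} : Finset W),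
    ∀ (Rw : ℕ) (D A : Finset (W × Site 2)), D ⊆ ballFin X τ Rw ×ˢ box 2 (25 * (Cc κ X hqt p hT δA M).r) → A ⊆ D →
      (∀ a ∈ A, a.1 ∈ ballFin X τ R₀') → (bondPercolation (X □ zdGraph 2) q).real (excess X τ R' D A) ≤ η :=
  fun R₀' R' hR' τ hτ Rw D A hD hA hnear => (excessRadiusAt_spec_singleton' X (Finset.mem_insert_self w _) _
    (half_pos (δmin_pos κ nR hδA)) (tube_at hat) R₀' R' hR' τ hτ Rw D A hD hA hnear).trans hη

/-- **The excess radius at `q` over the representatives** (the inner routes' `hR₁`, frame `γ c ∈ reps`), any `η ≥ δmin/2`. [folklore] -/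
theorem hRexV_at {η : ℝ} (hη : ηc κ δA ≤ η) : ∀ R₀' R', Rexc κ X hqt w p hT δA M q R₀' ≤ R' → ∀ τ ∈ reps X hqt,
    ∀ (Rw : ℕ) (D A : Finset (W × Site 2)), D ⊆ ballFin X τ Rw ×ˢ box 2 (25 * (Cc κ X hqt p hT δA M).r) → A ⊆ D →
      (∀ a ∈ A, a.1 ∈ ballFin X τ R₀') → (bondPercolation (X □ zdGraph 2) q).real (excess X τ R' D A) ≤ η :=
  fun R₀' R' hR' τ hτ Rw D A hD hA hnear => (excessRadiusAt_spec_subset X (Finset.subset_insert w _) _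
    (half_pos (δmin_pos κ nR hδA)) (tube_at hat) R₀' R' hR' τ hτ Rw D A hD hA hnear).trans hη

end AtQ

/-! ### The schedule and the radii by name -/

section Sched

variable {κ : ConcConsts} {W : Type} [DecidableEq W] [Countable W] {X : SimpleGraph W} [X.LocallyFinite] {hqt : IsQuasiTransitive X}
  {w : W} {p : unitInterval} {hT : TubeSubcritical X p} {δA : ℝ} {M : ℕ} {q : unitInterval}

/-- `(F)`: `2 L' + R₁ ρ ≤ gap ρ` with `R₁ ρ := Rex q (ρ + 1)`. [folklore] -/
theorem hgap_face (ρ : ℕ) : 2 * L'c κ X hqt w p hT δA M q + Rexc κ X hqt w p hT δA M q (ρ + 1) ≤ gapc κ X hqt w p hT δA M q ρ :=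
  two_mul_add_le_gapFn _ _ ρ

/-- `(C)`: `L' ≤ gap ρ`. [folklore] -/
theorem hgapL (ρ : ℕ) : L'c κ X hqt w p hT δA M q ≤ gapc κ X hqt w p hT δA M q ρ := le_gapFn _ _ ρ

/-- `(C)`: `Rex q (E g + 1) + L' ≤ E (g + 1)`. [folklore] -/
theorem hsch (g : ℕ) :
    Rexc κ X hqt w p hT δA M q (Erad (gapc κ X hqt w p hT δA M q) (fun _ => 0) (E₀c κ X hqt w p hT δA M q) g + 1) +
        L'c κ X hqt w p hT δA M q ≤ Erad (gapc κ X hqt w p hT δA M q) (fun _ => 0) (E₀c κ X hqt w p hT δA M q) (g + 1) :=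
  sch_gapFn _ _ _ g

/-- `(R)`: the root tube radius `F 1 - L' = E₀ + L' + 1 + Rex q (E₀ + 1)`. [folklore] -/
theorem hRt : Frad (gapc κ X hqt w p hT δA M q) (fun _ => 0) (E₀c κ X hqt w p hT δA M q) 1 - L'c κ X hqt w p hT δA M q =
    E₀c κ X hqt w p hT δA M q + L'c κ X hqt w p hT δA M q + 1 + Rexc κ X hqt w p hT δA M q (E₀c κ X hqt w p hT δA M q + 1) :=
  Frad_one_gapFn _ _ _

/-- `LA + ψ M ≤ L'` ((F)'s `hL`). [folklore] -/
theorem hL_face : LAc κ X hqt w p hT δA M q + ψ X hqt p hT M ≤ L'c κ X hqt w p hT δA M q := by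
  unfold L'c; omega

/-- `ψ (6t) + ψ M ≤ L'` ((C)'s `hLψ`, `hkits_tube`'s `hL`). [folklore] -/
theorem hL_reach : ψ X hqt p hT (6 * tc κ X hqt p hT δA M) + ψ X hqt p hT M ≤ L'c κ X hqt w p hT δA M q := by
  unfold L'c; omega

/-- `L' ≤ E₀` ((C)'s `hE₀L`). [folklore] -/
theorem L'_le_E₀ : L'c κ X hqt w p hT δA M q ≤ E₀c κ X hqt w p hT δA M q := le_rfl

/-- `L' ≤ E g` ((C)'s `hLE` at the realised tube radius). [folklore] -/
theorem L'_le_Erad (g : ℕ) : L'c κ X hqt w p hT δA M q ≤ Erad (gapc κ X hqt w p hT δA M q) (fun _ => 0) (E₀c κ X hqt w p hT δA M q) g :=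
  le_Erad_gapFn _ _ _ g

/-- `ψ (6 t) ≤ E₀` ((R)'s first hop at scale `6 t` inside the wired root cube). [folklore] -/
theorem ψ_top_le_E₀ : ψ X hqt p hT (6 * tc κ X hqt p hT δA M) ≤ E₀c κ X hqt w p hT δA M q := by unfold E₀c L'c; omega

/-- `ψ M ≤ E₀` ((F)'s `hψ`, (C)'s `hE₀M`, (R)'s `hin` fibre part). [folklore] -/
theorem ψ_le_E₀ : ψ X hqt p hT M ≤ E₀c κ X hqt w p hT δA M q := (ψ_le_ψ_top (κ := κ) (δA := δA)).trans ψ_top_le_E₀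

/-- `ψ M ≤ E g` ((C)'s `hnF` at the realised tube radius). [folklore] -/
theorem ψ_le_Erad (g : ℕ) : ψ X hqt p hT M ≤ Erad (gapc κ X hqt w p hT δA M q) (fun _ => 0) (E₀c κ X hqt w p hT δA M q) g :=
  (ψ_le_E₀ (κ := κ)).trans (le_Erad_gapFn _ _ _ g)

/-- The inner rim allowance: `ψ (6t) + ψ M + Rex q (ψ (6 t)) ≤ LA - (ψ (6 t) + ψ M)`. [folklore] -/
theorem inner_rim_le : ψ X hqt p hT (6 * tc κ X hqt p hT δA M) + ψ X hqt p hT M +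
    Rexc κ X hqt w p hT δA M q (ψ X hqt p hT (6 * tc κ X hqt p hT δA M)) ≤
      LAc κ X hqt w p hT δA M q - (ψ X hqt p hT (6 * tc κ X hqt p hT δA M) + ψ X hqt p hT M) := by
  unfold LAc; omega

end Sched

end Conc

end BoxProdZ2

end Transplant

end Summit.CriticalPhenomena.PercolationContinuityZ3.Theorems

end
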